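import Literature.MathematicalPhysics.QuantumFieldTheory.Balaban1983to89.B2Sect3AGaussianStep

/-!
# `Balaban1983to89.B2Ineq311` — [Balaban1982Higgs2] §3.A p. 585, (3.11): the «very weak» lower bounds
`G′_k ≧ γ₁μ₀²(Lᵏε)²I↾_{Λ₅⁽ᵏ⁾}`, `G″_k ≧ γ₁m²(Lᵏε)²I↾_{Λ₅⁽ᵏ⁾}` for the quadratic forms of the first four terms of (3.9) —
the printed derivation («it suffices to use the mass terms in the fundamental operators» / «as a corollary» of the
stronger estimate of Sect. 3.B) PROVED in the schematic matrix coordinates of `…B2Sect3AGaussianStep` (theorems only)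

statement-level skeleton of published theorems with citation tags; proofs where landed; nothing here is a claim about the Yang–Mills mass gap

CITATION HEADER.  T. Bałaban, *(Higgs)₂,₃ quantum fields in a finite volume. II. An upper bound*, Commun. Math. Phys.
**86** (1982) 555–594 [Balaban1982Higgs2] (cell paper B2; PDF held `paper:balaban1982-cmp86-higgs23-ii`, journal page =
PDF page + 554; p. 585 READ AS AN IMAGE on the ×2 render
`run/shared/lean/pub/pub-balaban/b2b-balaban-ref1/pages/1982-cmp86-higgs23-II/1982-cmp86-higgs23-II-p031-x2.png`).
Unit `lit-balaban-r02` gen 3 (B2 fold owner; HOME `run/shared/lean/pub/lit-balaban/`).  SKELETON row **B2.Eq3.11**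
((3.11)–(3.12); status before this file: the (3.11) display `absent`; the p. 586 consequence PROVED by p15
`B2Sect3AGaussianStep.sentence586`, which CONSUMES (3.11) as its hypothesis `∀ u, γ ℓ²(u·u) ≤ u·(G u)`; the «≦ O(1)(Lᵏε)^κ
for every κ» clause of (3.12) typed by r14 `B2StepK.RDecayBeatsPowers`).  This file supplies that hypothesis from the
printed mechanism, in the SAME coordinates (`G′_k = Qᵀ·diag(c)·Q + Δ`, see `B2Sect3AGaussianStep.eq317`).

WHAT IS PRINTED (verbatim, p. 585 [PDF 31]).  *"We need the estimates of the quadratic forms in (3.9). Let us denote the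
quadratic forms in A_k, φ_k, connected with the first four terms in the exponential under the integral (3.9), by
⟨A_k, G′_kA_k⟩, ⟨φ_k, G″_kφ_k⟩ correspondingly. We will give the estimates from below for these forms. It is sufficient to
get very weak estimates because we have the strong estimates (3.8), (3.10). To get them it suffices to use the mass terms
in the fundamental operators −Δ^η + μ₀²(Lᵏε)² and −Δ^{η,N}_{A^{(k)},Bᵏ(Λ₂^{(k−1)′})} + m²(Lᵏε)². In the next section of this
chapter we will formulate a much stronger estimate, which as a corollary gives
  G′_k ≧ γ₁μ₀²(Lᵏε)²I↾_{Λ₅⁽ᵏ⁾},  G″_k ≧ γ₁m²(Lᵏε)²I↾_{Λ₅⁽ᵏ⁾}.   (3.11)"*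

DICTIONARY (the schematic coordinates of `B2Sect3AGaussianStep`, ONE FIELD AT A TIME): the integration variable
`u : Y → ℝ` ↤ `A_k↾_{Λ₅⁽ᵏ⁾}` (resp. `φ_k↾_{Λ₅⁽ᵏ⁾}`); the «first term» data `Q : Matrix J Y ℝ`, weights `c : J → ℝ` ↤
`a_{l−k}(L^{l−k})^{d−2} ≥ 0`; the «third term» `Δ : Matrix Y Y ℝ` ↤ `Λ₅⁽ᵏ⁾Δ^{(k)}Λ₅⁽ᵏ⁾` (resp. `Λ₅⁽ᵏ⁾Δ^{(k)}(…)Λ₅⁽ᵏ⁾`), so that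
`G′_k = Qᵀ·diag(c)·Q + Δ`; `ℓ` ↤ `Lᵏε`; the «mass terms in the fundamental operators»: `Δ = N + μ₀²ℓ²·1` with `N`
non-negative (↤ `−Δ^η` resp. the Neumann covariant Laplacian), or — the «corollary» route — a Prop. 3.1-shaped lower bound
`γ₁μ₀²ℓ²(u·u) ≤ u·(Δu)` on the third term alone.

WHAT THIS MODULE PROVES.  `quadForm_avg_nonneg` (the averaging squares `u·(Qᵀdiag(c)Q u) = Σ_j c_j (Qu)_j² ≥ 0`),
`mass_term_lower` («it suffices to use the mass terms»: `N ≥ 0 ⇒ u·((N + m·1)u) ≥ m(u·u)`), **`ineq311`** ((3.11) for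
`G = Qᵀ·diag(c)·Q + Δ` from a lower bound on the Δ-form — the «corollary» step), `ineq311_of_mass_term` ((3.11) with
`γ₁ = 1` from the mass-term decomposition `Δ = N + μ₀²ℓ²·1`), `ineq311_feeds_sentence586` (the output IS the hypothesis
shape of `B2Sect3AGaussianStep.sentence586`).  Not here: Prop. 3.1 itself (`B2.Prop31Printed`, typed; proof deferred in
print to [B4]) and the identification of its quadratic form with the Δ-block of (3.9) (a bookkeeping over the sets
Λ₅⁽ʲ⁾ not transcribed).  No definitions, no `sorry`; axioms standard.

v1.1 (reading note, second reader r14 g4, `…B2Ineq311MassTerm` p248648): `ineq311_of_mass_term` takes the third-term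
operator of (3.9) to BE the fundamental operator `N + μ₀²ℓ²·1` (γ₁ = 1); the printed third term is the RG operator
`Δ^{(k)}` of (I.2.21), for which r14 proves (3.11) with the explicit uniform `γ₁ = a_k/(a_k + μ₀²(Lᵏε)²)` and feeds the
same corollary `ineq311`.  No statement of this file changed.
-/

namespace Literature.MathematicalPhysics.QuantumFieldTheory.Balaban1983to89.B2Ineq311

open Matrix Finset

variable {Y J : Type*} [Fintype Y] [Fintype J] [DecidableEq J]

/-- The «first term» of (3.9) is a sum of weighted squares: `u·(Qᵀ·diag(c)·Q u) = Σ_j c_j (Qu)_j²`.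
[cite: Balaban1982Higgs2, (3.9) p.585] -/
theorem quadForm_avg_eq (Q : Matrix J Y ℝ) (c : J → ℝ) (u : Y → ℝ) :
    u ⬝ᵥ ((Qᵀ * (diagonal c * Q)) *ᵥ u) = ∑ j, c j * (Q *ᵥ u) j ^ 2 := by
  rw [← Matrix.mulVec_mulVec, ← Matrix.mulVec_mulVec, Matrix.dotProduct_mulVec, Matrix.vecMul_transpose]
  simp only [dotProduct, Matrix.mulVec_diagonal, sq]
  exact Finset.sum_congr rfl fun j _ => by ring

/-- … hence non-negative for non-negative weights (`a_{l−k}(L^{l−k})^{d−2} ≥ 0`). [cite: Balaban1982Higgs2, (3.9) p.585] -/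
theorem quadForm_avg_nonneg (Q : Matrix J Y ℝ) {c : J → ℝ} (hc : ∀ j, 0 ≤ c j) (u : Y → ℝ) :
    0 ≤ u ⬝ᵥ ((Qᵀ * (diagonal c * Q)) *ᵥ u) := by
  rw [quadForm_avg_eq]
  exact Finset.sum_nonneg fun j _ => mul_nonneg (hc j) (sq_nonneg _)

omit [DecidableEq J] [Fintype J] in
/-- «it suffices to use the mass terms in the fundamental operators −Δ^η + μ₀²(Lᵏε)²»: if `Δ = N + m·1` with the form
of `N` non-negative, then `u·(Δu) ≥ m(u·u)`. [cite: Balaban1982Higgs2, (3.11) p.585] -/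
theorem mass_term_lower [DecidableEq Y] {N : Matrix Y Y ℝ} (hN : ∀ u : Y → ℝ, 0 ≤ u ⬝ᵥ (N *ᵥ u)) (m : ℝ) (u : Y → ℝ) :
    m * (u ⬝ᵥ u) ≤ u ⬝ᵥ ((N + m • (1 : Matrix Y Y ℝ)) *ᵥ u) := by
  have h := hN u
  rw [Matrix.add_mulVec, dotProduct_add, Matrix.smul_mulVec, Matrix.one_mulVec, dotProduct_smul, smul_eq_mul]
  linarith

/-- **(3.11)** p. 585, the «corollary» step, schematic coordinates: if the third term of (3.9) obeys the Prop. 3.1-shaped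
bound `γ₁μ₀²ℓ²(u·u) ≤ u·(Δu)` and the averaging weights are non-negative, then `G′_k = Qᵀ·diag(c)·Q + Δ ≧ γ₁μ₀²ℓ²·I`, i.e.
`γ₁μ₀²ℓ²(u·u) ≤ u·(G′_k u)` for every `u` (the same with `m` for `μ₀` gives the `G″_k` half).
[cite: Balaban1982Higgs2, (3.11) p.585] -/
theorem ineq311 (Q : Matrix J Y ℝ) {c : J → ℝ} (hc : ∀ j, 0 ≤ c j) (Δ : Matrix Y Y ℝ) {γ₁ μ₀ ℓ : ℝ}
    (hΔ : ∀ u : Y → ℝ, γ₁ * μ₀ ^ 2 * ℓ ^ 2 * (u ⬝ᵥ u) ≤ u ⬝ᵥ (Δ *ᵥ u)) (u : Y → ℝ) :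
    γ₁ * μ₀ ^ 2 * ℓ ^ 2 * (u ⬝ᵥ u) ≤ u ⬝ᵥ ((Qᵀ * (diagonal c * Q) + Δ) *ᵥ u) := by
  have h1 := quadForm_avg_nonneg Q hc u
  have h2 := hΔ u
  rw [Matrix.add_mulVec, dotProduct_add]
  linarith

/-- **(3.11) from the mass terms** (γ₁ = 1): with `Δ = N + μ₀²ℓ²·1`, `N ≥ 0` as a form (the «fundamental operator»
`−Δ^η + μ₀²(Lᵏε)²` restricted to Λ₅⁽ᵏ⁾), `G′_k ≧ μ₀²ℓ²·I`.  READING NOTE (v1.1, second reader r14 g4): this models the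
third-term operator of (3.9) DIRECTLY as the fundamental operator `H = N + μ₀²ℓ²·1`; in print that third term is the RG
operator `Δ^{(k)} = a_k·1 − a_k²Q_kG_kQ_kᵀ` of (I.2.21) built FROM `H = G_k⁻¹ − a_kQ_kᵀQ_k`, for which (3.11) holds with the
smaller constant `γ₁ = a_k/(a_k + μ₀²(Lᵏε)²) ≥ a_∞/(a_∞ + μ₀²)` — PROVED in `…B2Ineq311MassTerm.rgOp_form_lower` /
`gamma1_uniform` / `ineq311_rgOp` (r14 g4), which feeds `ineq311` below exactly as this corollary does.
[cite: Balaban1982Higgs2, (3.11) p.585] -/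
theorem ineq311_of_mass_term [DecidableEq Y] (Q : Matrix J Y ℝ) {c : J → ℝ} (hc : ∀ j, 0 ≤ c j) {N : Matrix Y Y ℝ}
    (hN : ∀ u : Y → ℝ, 0 ≤ u ⬝ᵥ (N *ᵥ u)) (μ₀ ℓ : ℝ) (u : Y → ℝ) :
    μ₀ ^ 2 * ℓ ^ 2 * (u ⬝ᵥ u) ≤ u ⬝ᵥ ((Qᵀ * (diagonal c * Q) + (N + (μ₀ ^ 2 * ℓ ^ 2) • (1 : Matrix Y Y ℝ))) *ᵥ u) := by
  have h := ineq311 Q hc (N + (μ₀ ^ 2 * ℓ ^ 2) • (1 : Matrix Y Y ℝ)) (γ₁ := 1) (μ₀ := μ₀) (ℓ := ℓ)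
    (fun v => by simpa [one_mul] using mass_term_lower hN (μ₀ ^ 2 * ℓ ^ 2) v) u
  simpa [one_mul] using h

/-- The output of `ineq311` IS the hypothesis shape `∀ u, γ ℓ²(u·u) ≤ u·(G u)` (with `γ = γ₁μ₀²`) under which p15's
`B2Sect3AGaussianStep.sentence586` proves the p. 586 sentence («G′_k − H′_k … positive and satisfy (3.11) with ½γ₁»).
[cite: Balaban1982Higgs2, (3.11) p.585, p.586] -/
theorem ineq311_feeds_sentence586 (Q : Matrix J Y ℝ) {c : J → ℝ} (hc : ∀ j, 0 ≤ c j) (Δ : Matrix Y Y ℝ)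
    {γ₁ μ₀ ℓ : ℝ} (hΔ : ∀ u : Y → ℝ, γ₁ * μ₀ ^ 2 * ℓ ^ 2 * (u ⬝ᵥ u) ≤ u ⬝ᵥ (Δ *ᵥ u)) :
    ∀ u : Y → ℝ, (γ₁ * μ₀ ^ 2) * ℓ ^ 2 * (u ⬝ᵥ u) ≤ u ⬝ᵥ ((Qᵀ * (diagonal c * Q) + Δ) *ᵥ u) := by
  intro u
  have h := ineq311 Q hc Δ hΔ u
  linarith

end Literature.MathematicalPhysics.QuantumFieldTheory.Balaban1983to89.B2Ineq311
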